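import Summits.ResolutionOfSingularities.KangarooAtlas.MizutaniExtremalProfile
import Summits.ResolutionOfSingularities.KangarooAtlas.MizutaniMultiplicity
import HarnessLib

/-!
# The profile bound at a point of `ℙ^n_k`: `2p + dim_k span{ξ_i^p : i ∈ supp f} ≤ #supp(f) + 1` (Mizutani 1973, proof of Thm. 2.8)

Cell `pub-rosobs`, Mizutani enclosure (seat mizutani-encloser-2, gen 6). AI-written; AI review is weaker than expert
review; NOT a resolution-of-singularities theorem (summit relevance C).

Sequel of `MizutaniExtremalProfile.lean` (tower level).  Here `𝔭` is a point of `ℙ^n_k` through which NO linear form passes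
(`invForms k p 𝔭 0 = ⊥`, Mizutani's «`V ∩ W = {0}`»), `ξ_i ∈ S/𝔭` the coordinates, and `f ∈ (L_B)_1(𝔭)` a nonzero invariant
additive form of level one (coefficient vector).  Realising the tensors `ρ_j(f) = Σ_i f_i ⊗ c_{ij}` (`ξ_i^p = Σ_j c_{ij} m_j`,
`MizutaniInvFormsTensor.lean`) in a finite `p`-independent envelope `F = k^p(b)` (`MizutaniPIndependent/PTowerFin.lean`) and applying
the tower-level profile bound gives:

* `finrank_span_image_algebraMap_le` — scalar extension does not increase the dimension of a span (`F ⊆ k`);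
* **`two_mul_add_finrank_span_xi_pow_le`** (`_of_not_mem_span`: for any point and a NEW form `f ∉ k·F((L_B)_0)`) —
  `2p + dim_k span_k {ξ_i^p : i ∈ supp f} ≤ #supp(f) + 1`: the `p`-th powers of the coordinates occurring in `f` span at most
  `#supp(f) + 1 − 2p` dimensions in `S/𝔭` (Mizutani: `θ_1(f)`, of dimension `≥ 2p − 1`, consists of additive forms through the point
  supported on `supp f`);
* `xi_ne_zero_of_invForms_zero_eq_bot`, **`two_mul_le_card_fsupp`** (`_of_not_mem_span`) — every nonzero (new) invariant form of level one
  has `≥ 2p` nonzero coefficients;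
* **`mem_span_xi_pow_of_card_fsupp_eq`** — if `#supp(f) = 2p` exactly, then for `i, j ∈ supp f` the powers `ξ_i^p`, `ξ_j^p` are
  `k`-proportional (`ξ_i^p ∈ k ∙ ξ_j^p`).

## References

* H. Mizutani, *Hironaka's additive group schemes*, Nagoya Math. J. 52 (1973) 85–95, proof of Thm. 2.8 (p. 90–91).
  [Mizutani1973HironakaGroupSchemes]
* T. Oda, *Hironaka's additive group scheme, II*, Publ. RIMS 19 (1983), Cor. 2.3, Thm. 3.1. [Oda1983HironakaGroupSchemeII]
-/

noncomputable section

open MvPolynomial TensorProduct Literature.AlgebraicGeometry.Resolution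
  Literature.AlgebraicGeometry.Resolution.HironakaScheme

namespace Summit.ResolutionOfSingularities.KangarooAtlas.Mizutani

universe u

/-! ## Scalar extension does not increase the dimension of a span -/

section ScalarExtension

variable {R A : Type*} [Field R] [Field A] [Algebra R A] {ι : Type*} {m : Type*} [Fintype m]

/-- For vectors `u_i ∈ R^m` and a field extension `R → A`: `dim_A span_A {u_i} ≤ dim_R span_R {u_i}` (the `A`-span is spanned by an
`R`-basis of the `R`-span). [folklore] -/
theorem finrank_span_image_algebraMap_le (u : ι → m → R) (S : Set ι) :
    Module.finrank A (Submodule.span A ((fun i => fun j => algebraMap R A (u i j)) '' S)) ≤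
      Module.finrank R (Submodule.span R (u '' S)) := by
  classical
  set W := Submodule.span R (u '' S) with hW
  set b := Module.finBasis R W with hb
  -- the `R`-linear scalar extension `φ : R^m → A^m`
  set φ : (m → R) →ₗ[R] (m → A) :=
    { toFun := fun v j => algebraMap R A (v j)
      map_add' := fun v v' => by funext j; simp
      map_smul' := fun c v => by funext j; simp [Algebra.smul_def] } with hφ
  have hφapply : ∀ (v : m → R), φ v = fun j => algebraMap R A (v j) := fun v => rfl
  have hle : Submodule.span A ((fun i => fun j => algebraMap R A (u i j)) '' S) ≤
      Submodule.span A (Set.range fun l => φ (b l : m → R)) := by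
    rw [Submodule.span_le]
    rintro _ ⟨i, hi, rfl⟩
    have hui : u i ∈ W := Submodule.subset_span ⟨i, hi, rfl⟩
    have hrepr := b.sum_repr ⟨u i, hui⟩
    have hrepr' : u i = ∑ l, b.repr ⟨u i, hui⟩ l • (b l : m → R) := by
      have := congrArg (fun w : W => (w : m → R)) hrepr
      simp only [Submodule.coe_sum, Submodule.coe_smul] at this
      exact this.symm
    show φ (u i) ∈ Submodule.span A (Set.range fun l => φ (b l : m → R))
    rw [hrepr', map_sum]
    refine Submodule.sum_mem _ fun l _ => ?_
    rw [LinearMap.map_smul, ← IsScalarTower.algebraMap_smul A (b.repr ⟨u i, hui⟩ l) (φ (b l : m → R))]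
    exact Submodule.smul_mem _ _ (Submodule.subset_span ⟨l, rfl⟩)
  calc Module.finrank A (Submodule.span A ((fun i => fun j => algebraMap R A (u i j)) '' S))
      ≤ Module.finrank A (Submodule.span A (Set.range fun l => φ (b l : m → R))) := Submodule.finrank_mono hle
    _ ≤ Fintype.card (Fin (Module.finrank R W)) := finrank_range_le_card _
    _ = Module.finrank R W := Fintype.card_fin _

end ScalarExtension

/-! ## The profile bound at a point -/

section PointProfile

variable (k : Type u) [Field k] (p : ℕ) [hp : Fact p.Prime] [CharP k p] {n : ℕ}
  (𝔭 : Ideal (MvPolynomial (Fin (n + 1)) k))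

/-- With no linear form through the point, no coordinate vanishes: `ξ_i ≠ 0` in `S/𝔭`. [cite: Mizutani1973HironakaGroupSchemes, Thm. 2.8 (V ∩ W = {0})] -/
theorem xi_ne_zero_of_invForms_zero_eq_bot (h0 : invForms k p 𝔭 0 = ⊥) (i : Fin (n + 1)) : xi k 𝔭 i ≠ 0 := by
  intro h
  have hX : (X i : MvPolynomial (Fin (n + 1)) k) ∈ 𝔭 := by
    unfold xi at h
    exact Ideal.Quotient.eq_zero_iff_mem.mp h
  have hmem : (Pi.single i 1 : Fin (n + 1) → k) ∈ invForms k p 𝔭 0 := by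
    rw [mem_invForms_zero_iff]
    have : addForm k p 0 (Pi.single i 1 : Fin (n + 1) → k) = X i := by
      unfold addForm
      rw [Fintype.sum_eq_single i (fun j hj => by rw [Pi.single_eq_of_ne hj, C_0, zero_mul]), Pi.single_eq_same,
        C_1, one_mul, pow_zero, pow_one]
    rw [this]
    exact hX
  rw [h0, Submodule.mem_bot] at hmem
  have h1 : (Pi.single i 1 : Fin (n + 1) → k) i = 0 := by rw [hmem, Pi.zero_apply]
  rw [Pi.single_eq_same] at h1
  exact one_ne_zero h1

/-- **THE PROFILE BOUND AT A POINT** (Mizutani's `dim θ_1(f) ≥ 2p − 1`, in rank form): let `𝔭` be a point of `ℙ^n_k` and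
`f ∈ (L_B)_1(𝔭)` an invariant additive form of level one which is NEW (not in `k · F((L_B)_0)`).  Then the `p`-th powers `ξ_i^p` of
the coordinates occurring in `f` span at most `#supp(f) + 1 − 2p` dimensions in `S/𝔭`:
`2p + dim_k span_k {ξ_i^p : f_i ≠ 0} ≤ #supp(f) + 1`. [cite: Mizutani1973HironakaGroupSchemes, proof of Thm. 2.8 (p. 90: dim θ_1(f) ≥ 2p − 1, θ_1(f) ⊂ forms through the point)] -/
theorem two_mul_add_finrank_span_xi_pow_le_of_not_mem_span (hP : IsPoint k 𝔭) {f : Fin (n + 1) → k}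
    (hf : f ∈ invForms k p 𝔭 1)
    (hnot : f ∉ Submodule.span k (frobVec k p 1 '' (invForms k p 𝔭 0 : Set (Fin (n + 1) → k)))) :
    2 * p + Module.finrank k (Submodule.span k ((fun i => xi k 𝔭 i ^ p) '' (fsupp f : Set (Fin (n + 1))))) ≤
      (fsupp f).card + 1 := by
  classical
  -- (1) `f` is new at level `0 + 1`, hence has a genuine tensor `ρ_{j₀}(f)`
  have hf' : f ∈ invForms k p 𝔭 (0 + 1) := hf
  obtain ⟨j₀, hJ₀, hI₀⟩ := exists_rho_not_mem_split k p 𝔭 hP.1 0 hf' hnot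
  have hvJ : ∀ j, rho k p 𝔭 (0 + 1) j f ∈
      KaehlerDifferential.ideal (frobPow k p (0 + 1)) k ^ p ^ (0 + 1) := (mem_invForms_iff_rho k p 𝔭 _ f).mp hf'
  -- (2) a finite `p`-independent envelope `F = k^p(b)` containing the `f_i`, the `c_{ij}` and witnesses for all `ρ_j(f) ∈ J^p`
  haveI : Infinite k := infinite_of_mem_pow_not_mem (m := p ^ (0 + 1) - 1)
    (by rw [← pow_eq_sub_one_add_one p (0 + 1)]; exact hvJ j₀) hI₀
  have hY : ∀ j, ∃ Y : Finset k, Realised (frobPow k p (0 + 1)) Y (p ^ (0 + 1)) (rho k p 𝔭 (0 + 1) j f) :=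
    fun j => exists_finset_realised_pow (K := frobPow k p (0 + 1)) (p ^ (0 + 1)) (hvJ j)
  choose Y hYj using hY
  set Y' : Finset k := Finset.univ.biUnion Y ∪ Finset.univ.image f ∪
    Finset.univ.image (fun ij : Fin (n + 1) × Fin (cdim k p 𝔭 (0 + 1)) => coord k p 𝔭 (0 + 1) ij.1 ij.2) with hY'
  obtain ⟨s, b, hb1, hY'F⟩ := exists_pIndep_adjoin (p := p) (0 + 1) Y'
  have hbe : PIndep p (0 + 1) b := hb1.of_one _ (Nat.le_add_left 1 0)
  have hYF : ∀ j, (↑(Y j) : Set k) ⊆ (towerField (0 + 1) b : Set k) := fun j =>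
    Set.Subset.trans (Finset.coe_subset.mpr ((Finset.subset_biUnion_of_mem Y (Finset.mem_univ j)).trans
      (Finset.subset_union_left.trans Finset.subset_union_left))) hY'F
  have hfF : ∀ i, f i ∈ towerField (0 + 1) b := fun i => hY'F (by
    rw [hY', Finset.coe_union, Finset.coe_union]
    exact Or.inl (Or.inr (by simp)))
  have hcF : ∀ i j, coord k p 𝔭 (0 + 1) i j ∈ towerField (0 + 1) b := fun i j => hY'F (by
    rw [hY', Finset.coe_union]
    exact Or.inr (by simp only [Finset.coe_image, Finset.coe_univ, Set.image_univ, Set.mem_range]; exact ⟨(i, j), rfl⟩))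
  -- the data inside `F`
  set v : Fin (n + 1) → towerField (0 + 1) b := fun i => ⟨f i, hfF i⟩ with hv
  set W : Fin (cdim k p 𝔭 (0 + 1)) → Fin (n + 1) → towerField (0 + 1) b :=
    fun j i => ⟨coord k p 𝔭 (0 + 1) i j, hcF i j⟩ with hWdef
  have hmap : ∀ j, tensorIncl (frobPow k p (0 + 1)) (towerField (0 + 1) b) (pairTensor (frobPow k p (0 + 1)) (W j) v) =
      rho k p 𝔭 (0 + 1) j f := by
    intro j
    rw [pairTensor_apply, rho_apply, map_sum]
    refine Finset.sum_congr rfl fun i _ => ?_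
    rw [Algebra.TensorProduct.map_tmul]
    rfl
  have hWJ : ∀ j, pairTensor (frobPow k p (0 + 1)) (W j) v ∈
      KaehlerDifferential.ideal (frobPow k p (0 + 1)) (towerField (0 + 1) b) ^ p ^ (0 + 1) := by
    intro j
    obtain ⟨ω₂, hω₂J, hω₂eq⟩ := ((realised_iff (frobPow k p (0 + 1))).mp (hYj j)) (towerField (0 + 1) b) (hYF j)
    have : ω₂ = pairTensor (frobPow k p (0 + 1)) (W j) v :=
      tensorIncl_injective (frobPow k p (0 + 1)) (towerField (0 + 1) b) (hω₂eq.trans (hmap j).symm)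
    rw [← this]
    exact hω₂J
  have hI' : pairTensor (frobPow k p (0 + 1)) (W j₀) v ∉
      frobPowerIdeal (frobPow k p (0 + 1)) p ^ p ^ (0 + 1 - 1) := by
    rw [Nat.add_sub_cancel]
    refine not_mem_of_map_not_mem (map_frobPowerIdeal_pow_le (frobPow k p (0 + 1)) (towerField (0 + 1) b) (p ^ 0)) ?_
    rw [hmap]
    exact hI₀
  -- (3) the tower-level profile bound, rank form
  have hT := (isRootTower_adjoin hbe).two_mul_pow_add_finrank_span_rows_le v (W j₀) (hWJ j₀) hI' W hWJ
  -- (4) `supp v = supp f`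
  have hsupp : fsupp v = fsupp f := by
    ext i
    rw [mem_fsupp, mem_fsupp, hv]
    exact not_congr Subtype.ext_iff
  rw [hsupp, pow_one] at hT
  -- (5) transfer to `k`: `dim_k span_k (rows) ≤ dim_F span_F (rows)`, and `ξ_i^p = Σ_j c_{ij} m_j` is the image of row `i`
  have h5 := finrank_span_image_algebraMap_le (R := towerField (0 + 1) b) (A := k)
    (fun i : Fin (n + 1) => fun j : Fin (cdim k p 𝔭 (0 + 1)) => W j i) (fsupp f : Set (Fin (n + 1)))
  have hrows : (fun i : Fin (n + 1) => fun j : Fin (cdim k p 𝔭 (0 + 1)) => algebraMap (towerField (0 + 1) b) k (W j i)) =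
      fun i j => coord k p 𝔭 (0 + 1) i j := by
    funext i j
    rfl
  rw [hrows] at h5
  -- the evaluation map `r ↦ Σ_j r_j m_j`
  set ev : (Fin (cdim k p 𝔭 (0 + 1)) → k) →ₗ[k] (MvPolynomial (Fin (n + 1)) k ⧸ 𝔭) :=
    Fintype.linearCombination k (fun j => ((cbasis k p 𝔭 (0 + 1) j : powSpan k p 𝔭 (0 + 1)) :
      MvPolynomial (Fin (n + 1)) k ⧸ 𝔭)) with hev
  have hev_row : ∀ i, ev (fun j => coord k p 𝔭 (0 + 1) i j) = xi k 𝔭 i ^ p := by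
    intro i
    have hp1 : xi k 𝔭 i ^ p = xi k 𝔭 i ^ p ^ (0 + 1) := by rw [zero_add, pow_one]
    rw [hev, Fintype.linearCombination_apply, hp1, xi_pow_eq_sum k p 𝔭 (0 + 1) i]
  have hspan : Submodule.span k ((fun i => xi k 𝔭 i ^ p) '' (fsupp f : Set (Fin (n + 1)))) =
      (Submodule.span k ((fun i : Fin (n + 1) => fun j => coord k p 𝔭 (0 + 1) i j) '' (fsupp f : Set (Fin (n + 1))))).map ev := by
    rw [Submodule.map_span, Set.image_image]
    congr 1
    exact Set.image_congr fun i _ => (hev_row i).symm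
  haveI : FiniteDimensional k (Submodule.span k ((fun i : Fin (n + 1) => fun j => coord k p 𝔭 (0 + 1) i j) ''
      (fsupp f : Set (Fin (n + 1))))) := FiniteDimensional.span_of_finite k ((Finset.finite_toSet _).image _)
  have h6 := Submodule.finrank_map_le ev
    (Submodule.span k ((fun i : Fin (n + 1) => fun j => coord k p 𝔭 (0 + 1) i j) '' (fsupp f : Set (Fin (n + 1)))))
  rw [← hspan] at h6
  omega

/-- With no linear form through the point, a nonzero form of level one is new: `f ∉ k · F((L_B)_0) = 0`. [folklore] -/
theorem not_mem_span_frobVec_of_invForms_zero_eq_bot (h0 : invForms k p 𝔭 0 = ⊥) {f : Fin (n + 1) → k} (hf0 : f ≠ 0) :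
    f ∉ Submodule.span k (frobVec k p 1 '' (invForms k p 𝔭 0 : Set (Fin (n + 1) → k))) := by
  rw [h0]
  intro hmem
  have himg : frobVec k p 1 '' ((⊥ : Submodule k (Fin (n + 1) → k)) : Set (Fin (n + 1) → k)) = {0} := by
    rw [Submodule.bot_coe, Set.image_singleton]
    congr 1
    funext j
    simp [frobVec, hp.out.ne_zero]
  rw [himg, Submodule.span_zero_singleton, Submodule.mem_bot] at hmem
  exact hf0 hmem

/-- The profile bound at a point with NO linear form through it, for every nonzero `f ∈ (L_B)_1`:
`2p + dim_k span_k {ξ_i^p : f_i ≠ 0} ≤ #supp(f) + 1`. [cite: Mizutani1973HironakaGroupSchemes, proof of Thm. 2.8 (p. 90: dim θ_1(f) ≥ 2p − 1, θ_1(f) ∩ W = {0})] -/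
theorem two_mul_add_finrank_span_xi_pow_le (hP : IsPoint k 𝔭) (h0 : invForms k p 𝔭 0 = ⊥)
    {f : Fin (n + 1) → k} (hf : f ∈ invForms k p 𝔭 1) (hf0 : f ≠ 0) :
    2 * p + Module.finrank k (Submodule.span k ((fun i => xi k 𝔭 i ^ p) '' (fsupp f : Set (Fin (n + 1))))) ≤
      (fsupp f).card + 1 :=
  two_mul_add_finrank_span_xi_pow_le_of_not_mem_span k p 𝔭 hP hf (not_mem_span_frobVec_of_invForms_zero_eq_bot k p 𝔭 h0 hf0)

/-- **A NEW invariant form of level one has at least `2p` nonzero coefficients at non-vanishing coordinates**: if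
`f ∈ (L_B)_1 ∖ k · F((L_B)_0)` and some coordinate `ξ_i` with `f_i ≠ 0` is nonzero in `S/𝔭`, then `#supp(f) ≥ 2p`.
[cite: Mizutani1973HironakaGroupSchemes, proof of Thm. 2.8 ("dim θ_1(f) ≥ 2p − 1 and dim W ≥ 2p")] -/
theorem two_mul_le_card_fsupp_of_not_mem_span (hP : IsPoint k 𝔭) {f : Fin (n + 1) → k} (hf : f ∈ invForms k p 𝔭 1)
    (hnot : f ∉ Submodule.span k (frobVec k p 1 '' (invForms k p 𝔭 0 : Set (Fin (n + 1) → k))))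
    {i : Fin (n + 1)} (hi : f i ≠ 0) (hξ : xi k 𝔭 i ≠ 0) : 2 * p ≤ (fsupp f).card := by
  classical
  have h := two_mul_add_finrank_span_xi_pow_le_of_not_mem_span k p 𝔭 hP hf hnot
  haveI := hP.1
  have hne : xi k 𝔭 i ^ p ≠ 0 := pow_ne_zero _ hξ
  have hmem : xi k 𝔭 i ^ p ∈ Submodule.span k ((fun i => xi k 𝔭 i ^ p) '' (fsupp f : Set (Fin (n + 1)))) :=
    Submodule.subset_span ⟨i, by rw [Finset.mem_coe, mem_fsupp]; exact hi, rfl⟩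
  haveI : FiniteDimensional k (Submodule.span k ((fun i => xi k 𝔭 i ^ p) '' (fsupp f : Set (Fin (n + 1))))) :=
    FiniteDimensional.span_of_finite k ((Finset.finite_toSet _).image _)
  have h1 : 1 ≤ Module.finrank k (Submodule.span k ((fun i => xi k 𝔭 i ^ p) '' (fsupp f : Set (Fin (n + 1))))) := by
    have := Submodule.finrank_mono (Submodule.span_le.mpr (Set.singleton_subset_iff.mpr hmem) :
      Submodule.span k {xi k 𝔭 i ^ p} ≤ _)
    rwa [finrank_span_singleton hne] at this
  omega

/-- **Every nonzero invariant additive form of level one has at least `2p` nonzero coefficients** (at a point with no linear form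
through it). [cite: Mizutani1973HironakaGroupSchemes, proof of Thm. 2.8 ("dim θ_1(f) ≥ 2p − 1 and dim W ≥ 2p")] -/
theorem two_mul_le_card_fsupp (hP : IsPoint k 𝔭) (h0 : invForms k p 𝔭 0 = ⊥)
    {f : Fin (n + 1) → k} (hf : f ∈ invForms k p 𝔭 1) (hf0 : f ≠ 0) : 2 * p ≤ (fsupp f).card := by
  classical
  have h := two_mul_add_finrank_span_xi_pow_le k p 𝔭 hP h0 hf hf0
  -- the span is nonzero: some `f_i ≠ 0`, and `ξ_i^p ≠ 0`
  obtain ⟨i, hi⟩ : ∃ i, f i ≠ 0 := by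
    by_contra hall
    push Not at hall
    exact hf0 (funext hall)
  haveI := hP.1
  have hne : xi k 𝔭 i ^ p ≠ 0 := pow_ne_zero _ (xi_ne_zero_of_invForms_zero_eq_bot k p 𝔭 h0 i)
  have hmem : xi k 𝔭 i ^ p ∈ Submodule.span k ((fun i => xi k 𝔭 i ^ p) '' (fsupp f : Set (Fin (n + 1)))) :=
    Submodule.subset_span ⟨i, by rw [Finset.mem_coe, mem_fsupp]; exact hi, rfl⟩
  haveI : FiniteDimensional k (Submodule.span k ((fun i => xi k 𝔭 i ^ p) '' (fsupp f : Set (Fin (n + 1))))) :=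
    FiniteDimensional.span_of_finite k ((Finset.finite_toSet _).image _)
  have h1 : 1 ≤ Module.finrank k (Submodule.span k ((fun i => xi k 𝔭 i ^ p) '' (fsupp f : Set (Fin (n + 1))))) := by
    have := Submodule.finrank_mono (Submodule.span_le.mpr (Set.singleton_subset_iff.mpr hmem) :
      Submodule.span k {xi k 𝔭 i ^ p} ≤ _)
    rwa [finrank_span_singleton hne] at this
  omega

/-- **If `#supp(f) = 2p` exactly, the `ξ_i^p`, `i ∈ supp f`, are pairwise `k`-proportional**: `ξ_i^p ∈ k ∙ ξ_j^p` for
`i, j ∈ supp f`. [cite: Mizutani1973HironakaGroupSchemes, proof of Thm. 2.8, Step (I) ("codim_k θ_1(f) = 1": the most generic point is a closed point)] -/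
theorem mem_span_xi_pow_of_card_fsupp_eq (hP : IsPoint k 𝔭) (h0 : invForms k p 𝔭 0 = ⊥)
    {f : Fin (n + 1) → k} (hf : f ∈ invForms k p 𝔭 1) (hcard : (fsupp f).card = 2 * p)
    {i j : Fin (n + 1)} (hi : f i ≠ 0) (hj : f j ≠ 0) :
    xi k 𝔭 i ^ p ∈ Submodule.span k {xi k 𝔭 j ^ p} := by
  classical
  haveI := hP.1
  have hf0 : f ≠ 0 := fun h => hi (by rw [h]; rfl)
  have h := two_mul_add_finrank_span_xi_pow_le k p 𝔭 hP h0 hf hf0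
  rw [hcard] at h
  set V := Submodule.span k ((fun i => xi k 𝔭 i ^ p) '' (fsupp f : Set (Fin (n + 1)))) with hV
  haveI : FiniteDimensional k V := FiniteDimensional.span_of_finite k ((Finset.finite_toSet _).image _)
  have hle1 : Module.finrank k V ≤ 1 := by omega
  have hjmem : xi k 𝔭 j ^ p ∈ V := Submodule.subset_span ⟨j, by rw [Finset.mem_coe, mem_fsupp]; exact hj, rfl⟩
  have himem : xi k 𝔭 i ^ p ∈ V := Submodule.subset_span ⟨i, by rw [Finset.mem_coe, mem_fsupp]; exact hi, rfl⟩
  have hne : xi k 𝔭 j ^ p ≠ 0 := pow_ne_zero _ (xi_ne_zero_of_invForms_zero_eq_bot k p 𝔭 h0 j)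
  have hle : Submodule.span k {xi k 𝔭 j ^ p} ≤ V := Submodule.span_le.mpr (Set.singleton_subset_iff.mpr hjmem)
  have heq : Submodule.span k {xi k 𝔭 j ^ p} = V :=
    Submodule.eq_of_le_of_finrank_le hle (by rw [finrank_span_singleton hne]; exact hle1)
  rw [heq]
  exact himem

end PointProfile

end Summit.ResolutionOfSingularities.KangarooAtlas.Mizutani

end
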